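import Summits.CriticalPhenomena.PercolationContinuityZ3.Theorems.Transplant.CayleyMilnorKernel
import Summits.CriticalPhenomena.PercolationContinuityZ3.Theorems.Transplant.ExpGrowthCriticalProbLtOne
import Literature.Probability.Percolation.CoveringMonotonicity
import Literature.Probability.Percolation.SubgraphMonotonicity
import HarnessLib

/-!
# `p_c` does not increase under QUOTIENTS of the group, for every generating set pushed forward:
# `p_c(Cay(Γ; S), g) ≤ p_c(Cay(Q; π(S)), π g)` — so `p_c < 1` DESCENDS from any quotient (weak covering; unconditional)

builds on p205010 (kernel theorem, internal audit signed; external expert review pending) — nothing in this file uses p205010; unconditional, no node.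
Lane `prim-bschramm`, seat `prim-bschramm-p4` gen 23 (PART C3 of `P4-GENERAL.md` §45).  Helper file (`--supports stmt-CriticalPhenomena-4575 --as helper`).

THE POINT.  Muchnik–Pak: "`p_c(G₁) ≤ p_c(G₂)` if `G₂` is a subgroup or a quotient group of `G₁`".  The SUBGROUP half, for every generating set of the
big group, is what `CayleyZSq…` / `CayleyProduct…` / `AutZSq…` do by Peierls (a subgroup is not a weak covering image).  The QUOTIENT half is a
one-liner over the tree's weak-covering monotonicity (Campanino / Benjamini–Schramm Thm. 1 / Lyons–Peres Thm. 6.47,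
`LyonsPeres647.theta_le_of_surjOn_neighborSet`): for ANY homomorphism `π : Γ →* Q` and ANY finite `S ⊆ Γ`, the map `π` sends the neighbourhood of
`g` in `Cay(Γ; S)` ONTO the neighbourhood of `π g` in `Cay(Q; π(S))` (`surjOn_neighborSet`), hence
**`CayleyQuot.theta_le`**: `θ_{Cay(Q;π S)}(π g, p) ≤ θ_{Cay(Γ;S)}(g, p)` and **`CayleyQuot.criticalProb_le`**:
`p_c(Cay(Γ; S), g) ≤ p_c(Cay(Q; π(S)), π g)`.  Consequently the HYPOTHESIS `p_c < 1` of Benjamini–Schramm's Conjecture 4 is inherited from every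
quotient: **`criticalProb_lt_one_of_quotient`**, and every "for EVERY generating set" certificate of the class map for `Q` (an embedded `ℤ²`, a
product of two infinite finitely generated subgroups, exponential growth, …) transfers to every group surjecting onto `Q`; e.g.
**`criticalProb_lt_one_of_quotient_expGrowth`** (a quotient Cayley graph of exponential growth).  Def-free (proof lane).
[cite: MuchnikPak2001, §1 ("p_c(G₁) ≤ p_c(G₂) if G₂ is a subgroup or a quotient group of G₁")] [cite: LyonsPeres2016, Thm. 6.47]
[cite: BenjaminiSchramm1996, Thm. 1; §2 Conj. 1]
-/

noncomputable section

namespace Summit.CriticalPhenomena.PercolationContinuityZ3.Theorems.Transplant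
open SimpleGraph Literature.Probability.LatticeModels Literature.Probability.Percolation
open Literature.Barriers.CriticalPhenomena (countable_of_connected_of_locallyFinite HasExponentialGrowth)
open scoped Classical

namespace CayleyQuot

variable {Γ Q : Type} [Group Γ] [Group Q]

/-- **A homomorphism is a weak covering of Cayley graphs**: `π` maps the neighbourhood of `g` in `Cay(Γ; S)` ONTO the neighbourhood of `π g` in
`Cay(Q; π(S))` (a neighbour `π(g)·π(s)^{±1} ≠ π g` forces `s ≠ 1`, so `g·s^{±1}` is a neighbour upstairs). [cite: LyonsPeres2016, §6.9 (weak covering maps)] -/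
theorem surjOn_neighborSet (π : Γ →* Q) (S : Finset Γ) (g : Γ) :
    Set.SurjOn π ((mulCayley (↑S : Set Γ)).neighborSet g) ((mulCayley (↑(S.image π) : Set Q)).neighborSet (π g)) := by
  intro y' hy'
  rw [mem_neighborSet, mulCayley_adj'] at hy'
  obtain ⟨hne, q, hq, hq'⟩ := hy'
  obtain ⟨s, hs, rfl⟩ := Finset.mem_image.1 (Finset.mem_coe.1 hq)
  have hs1 : s ≠ 1 := by
    rintro rfl
    rw [map_one, mul_one, mul_one] at hq'
    rcases hq' with h | h
    · exact hne h
    · exact hne h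
  rcases hq' with h | h
  · refine ⟨g * s, ?_, by rw [map_mul, h]⟩
    rw [mem_neighborSet, mulCayley_adj']
    exact ⟨fun e => hs1 (by simpa using e.symm), s, Finset.mem_coe.2 hs, Or.inl rfl⟩
  · refine ⟨g * s⁻¹, ?_, by rw [map_mul, map_inv, h, mul_inv_cancel_right]⟩
    rw [mem_neighborSet, mulCayley_adj']
    exact ⟨fun e => hs1 (by simpa using e.symm), s, Finset.mem_coe.2 hs, Or.inr (by rw [inv_mul_cancel_right])⟩

/-- **`θ` can only increase upstairs**: `θ_{Cay(Q; π S)}(π g, p) ≤ θ_{Cay(Γ; S)}(g, p)` for every homomorphism `π`, finite `S`, vertex `g`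
and density `p`. [cite: LyonsPeres2016, Thm. 6.47] [cite: BenjaminiSchramm1996, Thm. 1] -/
theorem theta_le [Countable Γ] [Countable Q] (π : Γ →* Q) (S : Finset Γ) (g : Γ) (p : unitInterval) :
    theta (mulCayley (↑(S.image π) : Set Q)) (π g) p ≤ theta (mulCayley (↑S : Set Γ)) g p :=
  LyonsPeres647.theta_le_of_surjOn_neighborSet _ _ π (surjOn_neighborSet π S) g p

/-- **`p_c` does not increase under quotients**: `p_c(Cay(Γ; S), g) ≤ p_c(Cay(Q; π(S)), π g)`. [cite: MuchnikPak2001, §1]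
[cite: LyonsPeres2016, Thm. 6.47] -/
theorem criticalProb_le [Countable Γ] [Countable Q] (π : Γ →* Q) (S : Finset Γ) (g : Γ) :
    criticalProb (mulCayley (↑S : Set Γ)) g ≤ criticalProb (mulCayley (↑(S.image π) : Set Q)) (π g) :=
  criticalProb_le_of_theta_le _ _ _ _ fun p => theta_le π S g p

/-- **`p_c < 1` DESCENDS from any quotient**: if `π : Γ ↠ Q` and `p_c(Cay(Q; π(S)), π g) < 1` then `p_c(Cay(Γ; S), g) < 1` (here `Γ = ⟨S⟩`
gives countability; surjectivity of `π` gives it for `Q`). [cite: MuchnikPak2001, §1] [cite: BenjaminiSchramm1996, §2 Conj. 1, Thm. 1] -/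
theorem criticalProb_lt_one_of_quotient (π : Γ →* Q) (hπ : Function.Surjective π) (S : Finset Γ)
    (hS : Subgroup.closure (S : Set Γ) = ⊤) (g : Γ) (h : criticalProb (mulCayley (↑(S.image π) : Set Q)) (π g) < 1) :
    criticalProb (mulCayley (↑S : Set Γ)) g < 1 := by
  haveI : Countable Γ := countable_of_connected_of_locallyFinite _ (CayleyScaled.connected_mulCayley_of_closure S hS) 1
  haveI : Countable Q := hπ.countable
  exact (criticalProb_le π S g).trans_lt h

/-- The pushed-forward alphabet generates the quotient. [folklore] -/
theorem closure_image_eq_top (π : Γ →* Q) (hπ : Function.Surjective π) (S : Finset Γ) (hS : Subgroup.closure (S : Set Γ) = ⊤) :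
    Subgroup.closure (↑(S.image π) : Set Q) = ⊤ := by
  rw [Finset.coe_image, ← MonoidHom.map_closure, hS, ← MonoidHom.range_eq_map, MonoidHom.range_eq_top.2 hπ]

/-- **Customer: a quotient whose Cayley graph has exponential growth** ⟹ `p_c(Cay(Γ; S), g) < 1` (Lyons' theorem downstairs, tree
`ExpGrowth.criticalProb_lt_one_of_hasExponentialGrowth`, then descent). [cite: LyonsPeres2016, Thm. 7.20, Thm. 6.47] -/
theorem criticalProb_lt_one_of_quotient_expGrowth (π : Γ →* Q) (hπ : Function.Surjective π) (S : Finset Γ)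
    (hS : Subgroup.closure (S : Set Γ) = ⊤) (hexp : HasExponentialGrowth (mulCayley (↑(S.image π) : Set Q))) (g : Γ) :
    criticalProb (mulCayley (↑S : Set Γ)) g < 1 := by
  haveI : Countable Q :=
    countable_of_connected_of_locallyFinite _ (CayleyScaled.connected_mulCayley_of_closure _ (closure_image_eq_top π hπ S hS)) 1
  exact criticalProb_lt_one_of_quotient π hπ S hS g
    (ExpGrowth.criticalProb_lt_one_of_hasExponentialGrowth _ (CayleyScaled.connected_mulCayley_of_closure _ (closure_image_eq_top π hπ S hS))
      (CayleyScaled.isQuasiTransitive_mulCayley _) hexp (π g))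

end CayleyQuot

end Summit.CriticalPhenomena.PercolationContinuityZ3.Theorems.Transplant
end
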